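import Literature.MathematicalPhysics.QuantumFieldTheory.Balaban1983to89.B13JointWalkExpansion

/-!
# Spine/NE5/ProductWalks — the PRODUCT of two walk-expanded kernel families is walk-expanded, with the concatenated walk
# distance (3.93) and the row-sum mechanism (3.92)–(3.94) at the ENTRY level of `B13JointWalkExpansion` (cell `pub-balaban-gaps`,
# seat `ne5` gen 5; building block of T9 = the resolvent ∕ Neumann step for the covariance `(A_t)⁻¹` along NE5's W2 pencil)

WHY.  `Spine/NE5/TwoRunPencilWalks` puts NE5's two-run pencil in the class BY LINEARITY for the Γ-kernel and the precision; the
covariance of a pencil member is `(A + tP)⁻¹ = A⁻¹ Σₙ (−tPA⁻¹)ⁿ` — PRODUCTS of walk-expanded families.  This file supplies the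
entry-level product step: per-term bound of a product of two walk terms by the row sum (2.61) paid from the excess rate of the
left factor and a FIBRE MULTIPLICITY `m` of the middle index (`TermKernels.hfib`-shape), with the inf-convolution `D₁ □ D₂` of
the walk distances (`B9SectDWalk.infConv`, (3.93)) — `norm_mul_entry_le_of_walks`; and the uniform majorant of the product
family's partial sums from `B9SectDWalk.MajSumLe.prod`.  Everything over the tree's torus geometry
`toB6 (torusGeom Nf 0 0 0) 0 True` (`htri_torusGeom`, `hdnn_torusGeom`, row sums `h261_torusGeom`).

MIRROR FORM (the right factor pays the row sum, under the symmetry of `d₁` — `B9SectDWalk.conv_walk_le_mirror`):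
`norm_mul_entry_le_of_walks_mirror`, `walkMajorants_mul_mirror`.  WHAT T9 STILL NEEDS (recorded, not done here): (ii) a RATE RELATION between precision and covariance that `B13TermWalkData` hides
in two independent `∃ρ`: the covariance `A⁻¹` (no rate drop in `WalkMajorants`) can only be the NON-paying factor, so every
Neumann step `P·(…)` is paid from the precision difference `P`'s drop: `ρ_E − ε_E ≤ ρ_C ≤ ρ_E − σ` (print: the covariance's walk
rate sits below the precision's — [B9] (3.108) vs Thm 3.12); (iii) the geometric series over the Neumann order under
`s·(mc)·K̄_E·K̄_C·c′ < 1` (`B9SectDWalk.neumann_majSumLe` pattern) and `HasSum` of `(A + tP)⁻¹` (finite torus: `Matrix.nonsing_inv`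
Neumann series).  With (ii)–(iii) the covariance of every member of NE5's precision pencil is a `WalkMajorants` family with
t-independent letters — the last walk-level input of Lemma 3 on the pencil (`Spine/NE5/TwoRunPencilWalks` §2 caveat (a)).

HONEST FRAMING.  Bookkeeping over landed hypothesis SHAPES and the tree's [B9] Sect. D walk algebra; nothing of Bałaban's is
constructed or asserted; NE5 NOT PRINTED ∕ NOT PROVED; (D4) NOT discharged; spine PROVED 0∕9; rung (B)+1 on a FIXED finite T⁴ —
NOT continuum, NOT infinite volume, NOT mass gap, NOT Clay.  HONEST DEPENDENCY: continuum YM on T⁴ ⇐ BetaPertH ∧ nine spine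
estimates; BetaPertH ⇐ (D1) ∧ (D4) ∧ CAP+tail.  0 sorry, 0 def.

Sources: [B9] = T. Bałaban, CMP **99** (1985) [Balaban1985BackgroundPropagators] (3.92)–(3.94) p. 410, (3.107)–(3.108) p. 416,
p. 422; [B6] = CMP **96** (1984) [Balaban1984PropagatorsII] (2.54) p. 233, Lemma 2.1 (2.61) p. 234; [II] = CMP **116** (1988)
[Balaban1988RG2Cluster] p. 13.  Nothing here is a claim about the Yang–Mills mass gap.
-/

noncomputable section

namespace Summit.QuantumFields.BalabanUV.T4Continuum.Spine.NE5.ProductWalks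

open Metric Set Finset
open Literature.MathematicalPhysics.QuantumFieldTheory.Balaban1983to89
open Literature.MathematicalPhysics.QuantumFieldTheory.Balaban1983to89.B9SectDWalk (Through MajSumLe DomBy infConv conv conv_walk_le)
open Literature.MathematicalPhysics.QuantumFieldTheory.Balaban1983to89.B9Thm34Ext (toB6)
open Literature.MathematicalPhysics.QuantumFieldTheory.Balaban1983to89.B9Thm37GlueTorus
  (torusGeom tdist1 tdist1_nonneg hdnn_torusGeom htri_torusGeom)
open Literature.MathematicalPhysics.QuantumFieldTheory.Balaban1983to89.TreeLengthTorus (TPt)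
open Literature.MathematicalPhysics.QuantumFieldTheory.Balaban1983to89.B5TorusCover (UT)
open Literature.MathematicalPhysics.QuantumFieldTheory.Balaban1983to89.B11SectG (RowSum)
open Literature.MathematicalPhysics.QuantumFieldTheory.Balaban1983to89.B13JointWalkExpansion (JointWalkExpansion WalkMajorants)

variable {ν : ℕ} {Nf : Fin ν → ℕ} [∀ i, NeZero (Nf i)]

-- The torus geometry of the walk objects is `toB6 (torusGeom Nf 0 0 0) 0 True` (one scale, sites = unit cubes `UT Nf`,
-- distance `d₁` = `tdist1 Nf`), spelled out below (no notation, kernel lane).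

omit [∀ i, NeZero (Nf i)] in
/-- **Fibre multiplicity**: a non-negative function of the locator summed over an index type with fibres of size `≤ m` is at
most `m` times its sum over the sites. [folklore] -/
theorem sum_loc_le_mul_sum {n : Type} [Fintype n] (locn : n → UT Nf) {m : ℕ}
    (hfib : ∀ y : UT Nf, (Finset.univ.filter fun k => locn k = y).card ≤ m) (f : UT Nf → ℝ) (hf : ∀ y, 0 ≤ f y) :
    ∑ k, f (locn k) ≤ m * ∑ y : UT Nf, f y := by
  classical
  rw [← Finset.sum_fiberwise_of_maps_to (g := locn) (t := Finset.univ) (fun k _ => Finset.mem_univ _)]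
  rw [Finset.mul_sum]
  refine Finset.sum_le_sum fun y _ => ?_
  rw [Finset.sum_congr rfl fun k hk => by rw [(Finset.mem_filter.1 hk).2], Finset.sum_const, nsmul_eq_mul]
  exact mul_le_mul_of_nonneg_right (by exact_mod_cast hfib y) (hf y)

/-- **PER-TERM BOUND OF A PRODUCT OF TWO WALK TERMS** ((3.92)→(3.94) at the entry level).  Left factor entries bounded by
`A₁e^{−ρ₁D₁(loc i, loc k)}` with `D₁` dominating the torus distance, right factor entries by `A₂e^{−ρ₂D₂(loc k, loc j)}`, middle
index with fibre multiplicity `≤ m`, row sum (2.61) at rate `σ` with constant `c`, `ρ + σ ≤ ρ₁`, `0 ≤ ρ ≤ ρ₂`: the product entry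
is bounded by `(m·c·A₁A₂)·e^{−ρ(D₁ □ D₂)(loc i, loc j)}`. [cite: Balaban1985BackgroundPropagators, (3.92)–(3.94) p.410; Balaban1984PropagatorsII, (2.61) p.234] -/
theorem norm_mul_entry_le_of_walks {p n q : Type} [Fintype n] (locp : p → UT Nf) (locn : n → UT Nf) (locq : q → UT Nf)
    {m : ℕ} (hfib : ∀ y : UT Nf, (Finset.univ.filter fun k => locn k = y).card ≤ m)
    {M₁ : Matrix p n ℂ} {M₂ : Matrix n q ℂ} {A₁ A₂ ρ₁ ρ₂ ρ σ c : ℝ} {D₁ D₂ : UT Nf → UT Nf → ℝ}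
    (hA₁ : 0 ≤ A₁) (hA₂ : 0 ≤ A₂) (hρ : 0 ≤ ρ) (hρ₂ : ρ ≤ ρ₂) (hσ : 0 ≤ σ) (hρ₁ : ρ + σ ≤ ρ₁)
    (hD₁ : DomBy (toB6 (torusGeom Nf 0 0 0) 0 True) D₁) (hD₂ : ∀ a b, 0 ≤ D₂ a b) (hrow : RowSum (toB6 (torusGeom Nf 0 0 0) 0 True) σ c)
    (h₁ : ∀ i k, ‖M₁ i k‖ ≤ A₁ * Real.exp (-(ρ₁ * D₁ (locp i) (locn k))))
    (h₂ : ∀ k j, ‖M₂ k j‖ ≤ A₂ * Real.exp (-(ρ₂ * D₂ (locn k) (locq j)))) (i : p) (j : q) :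
    ‖(M₁ * M₂) i j‖ ≤ (m * c * (A₁ * A₂)) * Real.exp (-(ρ * infConv (g := (toB6 (torusGeom Nf 0 0 0) 0 True)) D₁ D₂ (locp i) (locq j))) := by
  have hF : ∀ y : UT Nf, 0 ≤ Real.exp (-(ρ₁ * D₁ (locp i) y)) * Real.exp (-(ρ * D₂ y (locq j))) :=
    fun y => mul_nonneg (Real.exp_nonneg _) (Real.exp_nonneg _)
  calc ‖(M₁ * M₂) i j‖ = ‖∑ k, M₁ i k * M₂ k j‖ := by rw [Matrix.mul_apply]
    _ ≤ ∑ k, ‖M₁ i k‖ * ‖M₂ k j‖ := (norm_sum_le _ _).trans (le_of_eq (Finset.sum_congr rfl fun k _ => norm_mul _ _))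
    _ ≤ ∑ k, (A₁ * Real.exp (-(ρ₁ * D₁ (locp i) (locn k)))) * (A₂ * Real.exp (-(ρ * D₂ (locn k) (locq j)))) := by
        refine Finset.sum_le_sum fun k _ => mul_le_mul (h₁ i k) ((h₂ k j).trans ?_) (norm_nonneg _)
          (mul_nonneg hA₁ (Real.exp_nonneg _))
        exact mul_le_mul_of_nonneg_left (Real.exp_le_exp.2 (by nlinarith [hD₂ (locn k) (locq j)])) hA₂
    _ = (A₁ * A₂) * ∑ k, Real.exp (-(ρ₁ * D₁ (locp i) (locn k))) * Real.exp (-(ρ * D₂ (locn k) (locq j))) := by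
        rw [Finset.mul_sum]; exact Finset.sum_congr rfl fun k _ => by ring
    _ ≤ (A₁ * A₂) * (m * ∑ y : UT Nf, Real.exp (-(ρ₁ * D₁ (locp i) y)) * Real.exp (-(ρ * D₂ y (locq j)))) :=
        mul_le_mul_of_nonneg_left (sum_loc_le_mul_sum locn hfib _ hF) (mul_nonneg hA₁ hA₂)
    _ ≤ (A₁ * A₂) * (m * (c * Real.exp (-(ρ * infConv (g := (toB6 (torusGeom Nf 0 0 0) 0 True)) D₁ D₂ (locp i) (locq j))))) := by
        gcongr
        exact conv_walk_le (g := (toB6 (torusGeom Nf 0 0 0) 0 True)) (hdnn_torusGeom 0 0 0) hrow hσ hρ hρ₁ hD₁ (locp i) (locq j)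
    _ = (m * c * (A₁ * A₂)) * Real.exp (-(ρ * infConv (g := (toB6 (torusGeom Nf 0 0 0) 0 True)) D₁ D₂ (locp i) (locq j))) := by ring

/-- **The exponential of the inf-convolution is below the convolution sum**: for `ρ ≥ r₁, r₂ ≥ 0`… precisely `r₁ ≤ ρ`, `r₂ ≤ ρ`,
`D₁, D₂ ≥ 0`: `e^{−ρ(D₁ □ D₂)(a,b)} ≤ Σ_y e^{−r₁D₁(a,y)}·e^{−r₂D₂(y,b)}` (the infimum is attained on the finite torus; one term of a
non-negative sum). [folklore] -/
theorem exp_infConv_le_sum {D₁ D₂ : UT Nf → UT Nf → ℝ} {ρ r₁ r₂ : ℝ} (h₁ : r₁ ≤ ρ) (h₂ : r₂ ≤ ρ)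
    (hD₁ : ∀ a b, 0 ≤ D₁ a b) (hD₂ : ∀ a b, 0 ≤ D₂ a b) (a b : UT Nf) :
    Real.exp (-(ρ * infConv (g := (toB6 (torusGeom Nf 0 0 0) 0 True)) D₁ D₂ a b)) ≤
      ∑ y : UT Nf, Real.exp (-(r₁ * D₁ a y)) * Real.exp (-(r₂ * D₂ y b)) := by
  obtain ⟨y, hy⟩ := B9SectDWalk.exists_infConv_eq (g := (toB6 (torusGeom Nf 0 0 0) 0 True)) D₁ D₂ a b
  have hm₁ := mul_nonneg (sub_nonneg.2 h₁) (hD₁ a y)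
  have hm₂ := mul_nonneg (sub_nonneg.2 h₂) (hD₂ y b)
  have hexp : r₁ * D₁ a y + r₂ * D₂ y b ≤ ρ * infConv (g := (toB6 (torusGeom Nf 0 0 0) 0 True)) D₁ D₂ a b := by rw [hy]; nlinarith
  have hone : Real.exp (-(ρ * infConv (g := (toB6 (torusGeom Nf 0 0 0) 0 True)) D₁ D₂ a b)) ≤ Real.exp (-(r₁ * D₁ a y)) * Real.exp (-(r₂ * D₂ y b)) := by
    rw [← Real.exp_add]
    exact Real.exp_le_exp.2 (by linarith)
  exact hone.trans (Finset.single_le_sum (f := fun y => Real.exp (-(r₁ * D₁ a y)) * Real.exp (-(r₂ * D₂ y b)))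
    (fun _ _ => mul_nonneg (Real.exp_nonneg _) (Real.exp_nonneg _)) (Finset.mem_univ y))

/-- **UNIFORM MAJORANT OF THE PRODUCT FAMILY'S PARTIAL SUMS** ((3.108) summed, no walk counting — `MajSumLe.prod` + (2.54)∕(2.61)
shape closure `conv_exp_shape_le`).  If the two factor families' majorants at rates `r₁`, `r₂` have partial sums bounded by
`K̄₁e^{−κ₁d}`, `K̄₂e^{−κ₂d}`, then the product family's majorants `(C·A₁A₂)e^{−ρ(D₁ □ D₂)}` at any rate `ρ ≥ r₁, r₂` have partial
sums bounded by `C·K̄₁K̄₂c′·e^{−κd}` for `κ ≤ κ₂`, `κ + σ′ ≤ κ₁` (row sum at rate `σ′` with constant `c′`). [cite: Balaban1985BackgroundPropagators, p.416 and p.422; Balaban1984PropagatorsII, (2.54) p.233, (2.61) p.234] -/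
theorem majSumLe_mul {W₁ W₂ : Type} {A₁ : W₁ → ℝ} {A₂ : W₂ → ℝ} {D₁ : W₁ → UT Nf → UT Nf → ℝ}
    {D₂ : W₂ → UT Nf → UT Nf → ℝ} {r₁ r₂ ρ κ₁ κ₂ κ σ' c' Kbar₁ Kbar₂ C : ℝ}
    (hA₁ : ∀ ω, 0 ≤ A₁ ω) (hA₂ : ∀ ω, 0 ≤ A₂ ω) (hD₁ : ∀ ω a b, 0 ≤ D₁ ω a b) (hD₂ : ∀ ω a b, 0 ≤ D₂ ω a b)
    (h₁ : r₁ ≤ ρ) (h₂ : r₂ ≤ ρ) (hC : 0 ≤ C) (hK₁ : 0 ≤ Kbar₁) (hK₂ : 0 ≤ Kbar₂)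
    (hκ : 0 ≤ κ) (hκ₂ : κ ≤ κ₂) (hκ₁ : κ + σ' ≤ κ₁) (hrow : RowSum (toB6 (torusGeom Nf 0 0 0) 0 True) σ' c')
    (hs₁ : MajSumLe (g := (toB6 (torusGeom Nf 0 0 0) 0 True)) (fun ω a b => A₁ ω * Real.exp (-(r₁ * D₁ ω a b)))
      (fun a b => Kbar₁ * Real.exp (-(κ₁ * tdist1 Nf a b))))
    (hs₂ : MajSumLe (g := (toB6 (torusGeom Nf 0 0 0) 0 True)) (fun ω a b => A₂ ω * Real.exp (-(r₂ * D₂ ω a b)))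
      (fun a b => Kbar₂ * Real.exp (-(κ₂ * tdist1 Nf a b)))) :
    MajSumLe (g := (toB6 (torusGeom Nf 0 0 0) 0 True)) (fun (ω : W₁ × W₂) a b => (C * (A₁ ω.1 * A₂ ω.2)) *
        Real.exp (-(ρ * infConv (g := (toB6 (torusGeom Nf 0 0 0) 0 True)) (D₁ ω.1) (D₂ ω.2) a b)))
      (fun a b => (C * Kbar₁ * Kbar₂ * c') * Real.exp (-(κ * tdist1 Nf a b))) := by
  intro S a b
  have hprod := B9SectDWalk.MajSumLe.prod (g := (toB6 (torusGeom Nf 0 0 0) 0 True)) (κ := 1) zero_le_one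
    (fun ω a b => mul_nonneg (hA₁ ω) (Real.exp_nonneg _)) (fun ω a b => mul_nonneg (hA₂ ω) (Real.exp_nonneg _)) hs₁ hs₂
  -- termwise: product majorant ≤ C · conv 1 (maj₁ ω₁) (maj₂ ω₂)
  have hterm : ∀ ω : W₁ × W₂, (C * (A₁ ω.1 * A₂ ω.2)) * Real.exp (-(ρ * infConv (g := (toB6 (torusGeom Nf 0 0 0) 0 True)) (D₁ ω.1) (D₂ ω.2) a b)) ≤
      C * conv (g := (toB6 (torusGeom Nf 0 0 0) 0 True)) 1 (fun a' b' => A₁ ω.1 * Real.exp (-(r₁ * D₁ ω.1 a' b')))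
        (fun a' b' => A₂ ω.2 * Real.exp (-(r₂ * D₂ ω.2 a' b'))) a b := by
    intro ω
    have hle := exp_infConv_le_sum (Nf := Nf) h₁ h₂ (hD₁ ω.1) (hD₂ ω.2) a b
    have : conv (g := (toB6 (torusGeom Nf 0 0 0) 0 True)) 1 (fun a' b' => A₁ ω.1 * Real.exp (-(r₁ * D₁ ω.1 a' b')))
        (fun a' b' => A₂ ω.2 * Real.exp (-(r₂ * D₂ ω.2 a' b'))) a b =
        (A₁ ω.1 * A₂ ω.2) * ∑ y : UT Nf, Real.exp (-(r₁ * D₁ ω.1 a y)) * Real.exp (-(r₂ * D₂ ω.2 y b)) := by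
      rw [conv, Finset.mul_sum]; exact Finset.sum_congr rfl fun y _ => by ring
    rw [this, mul_assoc]
    exact mul_le_mul_of_nonneg_left (mul_le_mul_of_nonneg_left hle (mul_nonneg (hA₁ _) (hA₂ _))) hC
  calc ∑ ω ∈ S, (C * (A₁ ω.1 * A₂ ω.2)) * Real.exp (-(ρ * infConv (g := (toB6 (torusGeom Nf 0 0 0) 0 True)) (D₁ ω.1) (D₂ ω.2) a b))
      ≤ ∑ ω ∈ S, C * conv (g := (toB6 (torusGeom Nf 0 0 0) 0 True)) 1 (fun a' b' => A₁ ω.1 * Real.exp (-(r₁ * D₁ ω.1 a' b')))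
          (fun a' b' => A₂ ω.2 * Real.exp (-(r₂ * D₂ ω.2 a' b'))) a b := Finset.sum_le_sum fun ω _ => hterm ω
    _ = C * ∑ ω ∈ S, conv (g := (toB6 (torusGeom Nf 0 0 0) 0 True)) 1 (fun a' b' => A₁ ω.1 * Real.exp (-(r₁ * D₁ ω.1 a' b')))
          (fun a' b' => A₂ ω.2 * Real.exp (-(r₂ * D₂ ω.2 a' b'))) a b := by rw [Finset.mul_sum]
    _ ≤ C * conv (g := (toB6 (torusGeom Nf 0 0 0) 0 True)) 1 (fun a' b' => Kbar₁ * Real.exp (-(κ₁ * tdist1 Nf a' b')))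
          (fun a' b' => Kbar₂ * Real.exp (-(κ₂ * tdist1 Nf a' b'))) a b := mul_le_mul_of_nonneg_left (hprod S a b) hC
    _ ≤ C * (1 * Kbar₁ * Kbar₂ * c' * Real.exp (-(κ * tdist1 Nf a b))) :=
        mul_le_mul_of_nonneg_left (B9SectDWalk.conv_exp_shape_le (g := (toB6 (torusGeom Nf 0 0 0) 0 True)) (htri_torusGeom 0 0 0 0 True)
          (hdnn_torusGeom 0 0 0) hrow zero_le_one hK₁ hK₂ hκ hκ₂ hκ₁ a b) hC
    _ = (C * Kbar₁ * Kbar₂ * c') * Real.exp (-(κ * tdist1 Nf a b)) := by ring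


/-! ## Mirror form: the RIGHT factor pays the row sum (symmetry of `d₁`) -/

omit [∀ i, NeZero (Nf i)] in
/-- `d₁` is symmetric on the one-scale torus geometry (`tdist1_comm`). [folklore] -/
theorem distSymm_torus [∀ i, NeZero (Nf i)] : B9SectDSup.DistSymm (toB6 (torusGeom Nf 0 0 0) 0 True) :=
  fun y y' => B9Thm37GlueTorus.tdist1_comm y y'

/-- **Per-term product bound, mirror form**: the RIGHT factor (`A₂e^{−ρ₂D₂}`, `D₂ ≥ d₁`, `ρ + σ ≤ ρ₂`) pays the row sum, the left
factor only needs `ρ ≤ ρ₁`. [cite: Balaban1985BackgroundPropagators, (3.92)–(3.94) p.410; Balaban1984PropagatorsII, (2.61) p.234] -/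
theorem norm_mul_entry_le_of_walks_mirror {p n q : Type} [Fintype n] (locp : p → UT Nf) (locn : n → UT Nf)
    (locq : q → UT Nf) {m : ℕ} (hfib : ∀ y : UT Nf, (Finset.univ.filter fun k => locn k = y).card ≤ m)
    {M₁ : Matrix p n ℂ} {M₂ : Matrix n q ℂ} {A₁ A₂ ρ₁ ρ₂ ρ σ c : ℝ} {D₁ D₂ : UT Nf → UT Nf → ℝ}
    (hA₁ : 0 ≤ A₁) (hA₂ : 0 ≤ A₂) (hρ : 0 ≤ ρ) (hρ₁ : ρ ≤ ρ₁) (hσ : 0 ≤ σ) (hρ₂ : ρ + σ ≤ ρ₂)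
    (hD₁ : ∀ a b, 0 ≤ D₁ a b) (hD₂ : DomBy (toB6 (torusGeom Nf 0 0 0) 0 True) D₂)
    (hrow : RowSum (toB6 (torusGeom Nf 0 0 0) 0 True) σ c)
    (h₁ : ∀ i k, ‖M₁ i k‖ ≤ A₁ * Real.exp (-(ρ₁ * D₁ (locp i) (locn k))))
    (h₂ : ∀ k j, ‖M₂ k j‖ ≤ A₂ * Real.exp (-(ρ₂ * D₂ (locn k) (locq j)))) (i : p) (j : q) :
    ‖(M₁ * M₂) i j‖ ≤ (m * c * (A₁ * A₂)) *
      Real.exp (-(ρ * infConv (g := (toB6 (torusGeom Nf 0 0 0) 0 True)) D₁ D₂ (locp i) (locq j))) := by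
  have hF : ∀ y : UT Nf, 0 ≤ Real.exp (-(ρ * D₁ (locp i) y)) * Real.exp (-(ρ₂ * D₂ y (locq j))) :=
    fun y => mul_nonneg (Real.exp_nonneg _) (Real.exp_nonneg _)
  calc ‖(M₁ * M₂) i j‖ = ‖∑ k, M₁ i k * M₂ k j‖ := by rw [Matrix.mul_apply]
    _ ≤ ∑ k, ‖M₁ i k‖ * ‖M₂ k j‖ := (norm_sum_le _ _).trans (le_of_eq (Finset.sum_congr rfl fun k _ => norm_mul _ _))
    _ ≤ ∑ k, (A₁ * Real.exp (-(ρ * D₁ (locp i) (locn k)))) * (A₂ * Real.exp (-(ρ₂ * D₂ (locn k) (locq j)))) := by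
        refine Finset.sum_le_sum fun k _ => mul_le_mul ((h₁ i k).trans ?_) (h₂ k j) (norm_nonneg _)
          (mul_nonneg hA₁ (Real.exp_nonneg _))
        exact mul_le_mul_of_nonneg_left (Real.exp_le_exp.2 (by nlinarith [hD₁ (locp i) (locn k)])) hA₁
    _ = (A₁ * A₂) * ∑ k, Real.exp (-(ρ * D₁ (locp i) (locn k))) * Real.exp (-(ρ₂ * D₂ (locn k) (locq j))) := by
        rw [Finset.mul_sum]; exact Finset.sum_congr rfl fun k _ => by ring
    _ ≤ (A₁ * A₂) * (m * ∑ y : UT Nf, Real.exp (-(ρ * D₁ (locp i) y)) * Real.exp (-(ρ₂ * D₂ y (locq j)))) :=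
        mul_le_mul_of_nonneg_left (sum_loc_le_mul_sum locn hfib _ hF) (mul_nonneg hA₁ hA₂)
    _ ≤ (A₁ * A₂) * (m * (c * Real.exp (-(ρ * infConv (g := (toB6 (torusGeom Nf 0 0 0) 0 True)) D₁ D₂ (locp i) (locq j))))) := by
        gcongr
        exact B9SectDWalk.conv_walk_le_mirror (g := (toB6 (torusGeom Nf 0 0 0) 0 True)) distSymm_torus (hdnn_torusGeom 0 0 0)
          hrow hσ hρ hρ₂ hD₂ (locp i) (locq j)
    _ = (m * c * (A₁ * A₂)) * Real.exp (-(ρ * infConv (g := (toB6 (torusGeom Nf 0 0 0) 0 True)) D₁ D₂ (locp i) (locq j))) := by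
        ring

variable {d N' : ℕ} {p n q : Type} [Fintype n]
variable {E : Type*} [NormedAddCommGroup E] [NormedSpace ℂ E]
variable {c₀ : B13.Consts} {locp : p → UT Nf} {locn : n → UT Nf} {locq : q → UT Nf}
variable {K₁ : (TPt d N' → ℂ) → E → Matrix p n ℂ} {K₂ : (TPt d N' → ℂ) → E → Matrix n q ℂ}
variable {W₁ W₂ : Type} {T₁ : W₁ → (TPt d N' → ℂ) → E → Matrix p n ℂ} {T₂ : W₂ → (TPt d N' → ℂ) → E → Matrix n q ℂ}
variable {A₁ : W₁ → ℝ} {A₂ : W₂ → ℝ} {D₁ : W₁ → UT Nf → UT Nf → ℝ} {D₂ : W₂ → UT Nf → UT Nf → ℝ}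
variable {R ρ₁ ρ₂ r₁ r₂ ρ σ c κ₁ κ₂ κ σ' c' Kbar₁ Kbar₂ : ℝ} {m : ℕ}

omit [NormedSpace ℂ E] in
/-- **THE PRODUCT OF TWO WALK-EXPANDED FAMILIES IS WALK-EXPANDED** (entry level; [B9] p. 422 *"we replace each operator … by its
random walk expansion"*).  Data: expansions `K₁ = Σ T₁`, `K₂ = Σ T₂` (entrywise `HasSum` on polydisc × ball), per-term bounds at
rates `ρ₁` (left, walk distances dominating `d₁`) and `ρ₂` (right), partial-sum majorants at rates `r₁`, `r₂` by `K̄ᵢe^{−κᵢd}`,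
fibre multiplicity `m` of the middle locator, row sums at rates `σ` (constant `c`) and `σ′` (constant `c′`).  Rates: `ρ + σ ≤ ρ₁`,
`ρ ≤ ρ₂`, `r₁, r₂ ≤ ρ` (the product rate sits inside the left factor's drop window), `κ ≤ κ₂`, `κ + σ′ ≤ κ₁`.  Conclusion: the
product family `K₁K₂ = Σ_{(ω₁,ω₂)} T₁ω₁·T₂ω₂` is a `WalkMajorants` family with amplitudes `(mc)·A₁A₂`, walk distance `D₁ □ D₂`,
rate `ρ`, constant `(mc)·K̄₁K̄₂c′`, torus rate `κ`. [cite: Balaban1985BackgroundPropagators, (3.92)–(3.94) p.410, (3.107)–(3.108) p.416, p.422; Balaban1984PropagatorsII, (2.61) p.234] -/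
theorem walkMajorants_mul
    (hsum₁ : ∀ σ₀ : TPt d N' → ℂ, (∀ j, ‖σ₀ j‖ ≤ Real.exp c₀.κ₁) → ∀ u ∈ ball (0 : E) R,
      ∀ i k, HasSum (fun ω => T₁ ω σ₀ u i k) (K₁ σ₀ u i k))
    (hsum₂ : ∀ σ₀ : TPt d N' → ℂ, (∀ j, ‖σ₀ j‖ ≤ Real.exp c₀.κ₁) → ∀ u ∈ ball (0 : E) R,
      ∀ k j, HasSum (fun ω => T₂ ω σ₀ u k j) (K₂ σ₀ u k j))
    (hmaj₁ : ∀ ω, ∀ σ₀ : TPt d N' → ℂ, (∀ j, ‖σ₀ j‖ ≤ Real.exp c₀.κ₁) → ∀ u ∈ ball (0 : E) R,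
      ∀ i k, ‖T₁ ω σ₀ u i k‖ ≤ A₁ ω * Real.exp (-(ρ₁ * D₁ ω (locp i) (locn k))))
    (hmaj₂ : ∀ ω, ∀ σ₀ : TPt d N' → ℂ, (∀ j, ‖σ₀ j‖ ≤ Real.exp c₀.κ₁) → ∀ u ∈ ball (0 : E) R,
      ∀ k j, ‖T₂ ω σ₀ u k j‖ ≤ A₂ ω * Real.exp (-(ρ₂ * D₂ ω (locn k) (locq j))))
    (hs₁ : MajSumLe (g := (toB6 (torusGeom Nf 0 0 0) 0 True)) (fun ω a b => A₁ ω * Real.exp (-(r₁ * D₁ ω a b)))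
      (fun a b => Kbar₁ * Real.exp (-(κ₁ * tdist1 Nf a b))))
    (hs₂ : MajSumLe (g := (toB6 (torusGeom Nf 0 0 0) 0 True)) (fun ω a b => A₂ ω * Real.exp (-(r₂ * D₂ ω a b)))
      (fun a b => Kbar₂ * Real.exp (-(κ₂ * tdist1 Nf a b))))
    (hA₁ : ∀ ω, 0 ≤ A₁ ω) (hA₂ : ∀ ω, 0 ≤ A₂ ω) (hD₁ : ∀ ω a b, 0 ≤ D₁ ω a b) (hD₂ : ∀ ω a b, 0 ≤ D₂ ω a b)
    (hdom₁ : ∀ ω, DomBy (toB6 (torusGeom Nf 0 0 0) 0 True) (D₁ ω))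
    (hfib : ∀ y : UT Nf, (Finset.univ.filter fun k => locn k = y).card ≤ m)
    (hrow : RowSum (toB6 (torusGeom Nf 0 0 0) 0 True) σ c) (hrow' : RowSum (toB6 (torusGeom Nf 0 0 0) 0 True) σ' c')
    (hρ : 0 ≤ ρ) (hρ₂ : ρ ≤ ρ₂) (hσ : 0 ≤ σ) (hρ₁ : ρ + σ ≤ ρ₁) (hr₁ : r₁ ≤ ρ) (hr₂ : r₂ ≤ ρ)
    (hK₁ : 0 ≤ Kbar₁) (hK₂ : 0 ≤ Kbar₂) (hκ : 0 ≤ κ) (hκ₂ : κ ≤ κ₂) (hκ₁ : κ + σ' ≤ κ₁) (hc : 0 ≤ c) :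
    WalkMajorants c₀ locp locq (fun σ₀ u => K₁ σ₀ u * K₂ σ₀ u) R κ ((m * c) * Kbar₁ * Kbar₂ * c')
      (fun (ω : W₁ × W₂) σ₀ u => T₁ ω.1 σ₀ u * T₂ ω.2 σ₀ u) (fun ω => (m * c) * (A₁ ω.1 * A₂ ω.2))
      (fun ω => infConv (g := (toB6 (torusGeom Nf 0 0 0) 0 True)) (D₁ ω.1) (D₂ ω.2)) ρ where
  hasSum σ₀ hσ₀ u hu i j := by
    have hρρ₁ : ρ ≤ ρ₁ := by linarith
    have hr₁ρ₁ : r₁ ≤ ρ₁ := hr₁.trans hρρ₁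
    have hr₂ρ₂ : r₂ ≤ ρ₂ := hr₂.trans hρ₂
    show HasSum (fun ω : W₁ × W₂ => (T₁ ω.1 σ₀ u * T₂ ω.2 σ₀ u) i j) ((K₁ σ₀ u * K₂ σ₀ u) i j)
    have e : (fun ω : W₁ × W₂ => (T₁ ω.1 σ₀ u * T₂ ω.2 σ₀ u) i j) =
        fun ω => ∑ k, T₁ ω.1 σ₀ u i k * T₂ ω.2 σ₀ u k j := funext fun ω => Matrix.mul_apply
    rw [e, Matrix.mul_apply]
    refine hasSum_sum fun k _ => ?_
    -- the two real majorant families at the per-term rates are summable (bounded partial sums)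
    have ha0 : ∀ ω, 0 ≤ A₁ ω * Real.exp (-(ρ₁ * D₁ ω (locp i) (locn k))) := fun ω => mul_nonneg (hA₁ ω) (Real.exp_nonneg _)
    have hb0 : ∀ ω, 0 ≤ A₂ ω * Real.exp (-(ρ₂ * D₂ ω (locn k) (locq j))) := fun ω => mul_nonneg (hA₂ ω) (Real.exp_nonneg _)
    have ha : Summable fun ω => A₁ ω * Real.exp (-(ρ₁ * D₁ ω (locp i) (locn k))) := by
      refine summable_of_sum_le ha0 fun S => (Finset.sum_le_sum fun ω _ => ?_).trans (hs₁ S (locp i) (locn k))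
      exact mul_le_mul_of_nonneg_left
        (Real.exp_le_exp.2 (neg_le_neg (mul_le_mul_of_nonneg_right hr₁ρ₁ (hD₁ ω (locp i) (locn k))))) (hA₁ ω)
    have hb : Summable fun ω => A₂ ω * Real.exp (-(ρ₂ * D₂ ω (locn k) (locq j))) := by
      refine summable_of_sum_le hb0 fun S => (Finset.sum_le_sum fun ω _ => ?_).trans (hs₂ S (locn k) (locq j))
      exact mul_le_mul_of_nonneg_left
        (Real.exp_le_exp.2 (neg_le_neg (mul_le_mul_of_nonneg_right hr₂ρ₂ (hD₂ ω (locn k) (locq j))))) (hA₂ ω)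
    let f : W₁ → ℂ := fun ω => T₁ ω σ₀ u i k
    let g : W₂ → ℂ := fun ω => T₂ ω σ₀ u k j
    have hfg : Summable fun x : W₁ × W₂ => f x.1 * g x.2 := by
      refine Summable.of_norm_bounded (ha.mul_of_nonneg hb ha0 hb0) fun x => ?_
      exact (norm_mul_le (f x.1) (g x.2)).trans
        (mul_le_mul (hmaj₁ x.1 σ₀ hσ₀ u hu i k) (hmaj₂ x.2 σ₀ hσ₀ u hu k j) (norm_nonneg _) (ha0 x.1))
    exact HasSum.mul (f := f) (g := g) (hsum₁ σ₀ hσ₀ u hu i k) (hsum₂ σ₀ hσ₀ u hu k j) hfg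
  maj ω σ₀ hσ₀ u hu i j :=
    norm_mul_entry_le_of_walks locp locn locq hfib (hA₁ ω.1) (hA₂ ω.2) hρ hρ₂ hσ hρ₁ (hdom₁ ω.1) (hD₂ ω.2)
      hrow (fun i k => hmaj₁ ω.1 σ₀ hσ₀ u hu i k) (fun k j => hmaj₂ ω.2 σ₀ hσ₀ u hu k j) i j
  majSum :=
    majSumLe_mul (Nf := Nf) (C := m * c) hA₁ hA₂ hD₁ hD₂ hr₁ hr₂ (mul_nonneg (Nat.cast_nonneg m) hc) hK₁ hK₂ hκ hκ₂ hκ₁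
      hrow' hs₁ hs₂
  A_nonneg ω := mul_nonneg (mul_nonneg (Nat.cast_nonneg m) hc) (mul_nonneg (hA₁ ω.1) (hA₂ ω.2))

omit [NormedSpace ℂ E] in
/-- **The product family, mirror form** (the RIGHT factor pays: `ρ ≤ ρ₁`, `ρ + σ ≤ ρ₂`, `D₂ ≥ d₁`; everything else as in
`walkMajorants_mul`).  This is the form the covariance step uses at a boundary `A⁻¹·P` (the covariance on the left carries no
rate drop; the precision difference `P` on the right pays). [cite: Balaban1985BackgroundPropagators, (3.92)–(3.94) p.410, p.422] -/
theorem walkMajorants_mul_mirror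
    (hsum₁ : ∀ σ₀ : TPt d N' → ℂ, (∀ j, ‖σ₀ j‖ ≤ Real.exp c₀.κ₁) → ∀ u ∈ ball (0 : E) R,
      ∀ i k, HasSum (fun ω => T₁ ω σ₀ u i k) (K₁ σ₀ u i k))
    (hsum₂ : ∀ σ₀ : TPt d N' → ℂ, (∀ j, ‖σ₀ j‖ ≤ Real.exp c₀.κ₁) → ∀ u ∈ ball (0 : E) R,
      ∀ k j, HasSum (fun ω => T₂ ω σ₀ u k j) (K₂ σ₀ u k j))
    (hmaj₁ : ∀ ω, ∀ σ₀ : TPt d N' → ℂ, (∀ j, ‖σ₀ j‖ ≤ Real.exp c₀.κ₁) → ∀ u ∈ ball (0 : E) R,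
      ∀ i k, ‖T₁ ω σ₀ u i k‖ ≤ A₁ ω * Real.exp (-(ρ₁ * D₁ ω (locp i) (locn k))))
    (hmaj₂ : ∀ ω, ∀ σ₀ : TPt d N' → ℂ, (∀ j, ‖σ₀ j‖ ≤ Real.exp c₀.κ₁) → ∀ u ∈ ball (0 : E) R,
      ∀ k j, ‖T₂ ω σ₀ u k j‖ ≤ A₂ ω * Real.exp (-(ρ₂ * D₂ ω (locn k) (locq j))))
    (hs₁ : MajSumLe (g := (toB6 (torusGeom Nf 0 0 0) 0 True)) (fun ω a b => A₁ ω * Real.exp (-(r₁ * D₁ ω a b)))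
      (fun a b => Kbar₁ * Real.exp (-(κ₁ * tdist1 Nf a b))))
    (hs₂ : MajSumLe (g := (toB6 (torusGeom Nf 0 0 0) 0 True)) (fun ω a b => A₂ ω * Real.exp (-(r₂ * D₂ ω a b)))
      (fun a b => Kbar₂ * Real.exp (-(κ₂ * tdist1 Nf a b))))
    (hA₁ : ∀ ω, 0 ≤ A₁ ω) (hA₂ : ∀ ω, 0 ≤ A₂ ω) (hD₁ : ∀ ω a b, 0 ≤ D₁ ω a b) (hD₂ : ∀ ω a b, 0 ≤ D₂ ω a b)
    (hdom₂ : ∀ ω, DomBy (toB6 (torusGeom Nf 0 0 0) 0 True) (D₂ ω))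
    (hfib : ∀ y : UT Nf, (Finset.univ.filter fun k => locn k = y).card ≤ m)
    (hrow : RowSum (toB6 (torusGeom Nf 0 0 0) 0 True) σ c) (hrow' : RowSum (toB6 (torusGeom Nf 0 0 0) 0 True) σ' c')
    (hρ : 0 ≤ ρ) (hρ₁ : ρ ≤ ρ₁) (hσ : 0 ≤ σ) (hρ₂ : ρ + σ ≤ ρ₂) (hr₁ : r₁ ≤ ρ) (hr₂ : r₂ ≤ ρ)
    (hK₁ : 0 ≤ Kbar₁) (hK₂ : 0 ≤ Kbar₂) (hκ : 0 ≤ κ) (hκ₂ : κ ≤ κ₂) (hκ₁ : κ + σ' ≤ κ₁) (hc : 0 ≤ c) :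
    WalkMajorants c₀ locp locq (fun σ₀ u => K₁ σ₀ u * K₂ σ₀ u) R κ ((m * c) * Kbar₁ * Kbar₂ * c')
      (fun (ω : W₁ × W₂) σ₀ u => T₁ ω.1 σ₀ u * T₂ ω.2 σ₀ u) (fun ω => (m * c) * (A₁ ω.1 * A₂ ω.2))
      (fun ω => infConv (g := (toB6 (torusGeom Nf 0 0 0) 0 True)) (D₁ ω.1) (D₂ ω.2)) ρ where
  hasSum σ₀ hσ₀ u hu i j := by
    have hρρ₂ : ρ ≤ ρ₂ := by linarith
    have hr₁ρ₁ : r₁ ≤ ρ₁ := hr₁.trans hρ₁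
    have hr₂ρ₂ : r₂ ≤ ρ₂ := hr₂.trans hρρ₂
    show HasSum (fun ω : W₁ × W₂ => (T₁ ω.1 σ₀ u * T₂ ω.2 σ₀ u) i j) ((K₁ σ₀ u * K₂ σ₀ u) i j)
    have e : (fun ω : W₁ × W₂ => (T₁ ω.1 σ₀ u * T₂ ω.2 σ₀ u) i j) =
        fun ω => ∑ k, T₁ ω.1 σ₀ u i k * T₂ ω.2 σ₀ u k j := funext fun ω => Matrix.mul_apply
    rw [e, Matrix.mul_apply]
    refine hasSum_sum fun k _ => ?_
    have ha0 : ∀ ω, 0 ≤ A₁ ω * Real.exp (-(ρ₁ * D₁ ω (locp i) (locn k))) := fun ω => mul_nonneg (hA₁ ω) (Real.exp_nonneg _)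
    have hb0 : ∀ ω, 0 ≤ A₂ ω * Real.exp (-(ρ₂ * D₂ ω (locn k) (locq j))) := fun ω => mul_nonneg (hA₂ ω) (Real.exp_nonneg _)
    have ha : Summable fun ω => A₁ ω * Real.exp (-(ρ₁ * D₁ ω (locp i) (locn k))) := by
      refine summable_of_sum_le ha0 fun S => (Finset.sum_le_sum fun ω _ => ?_).trans (hs₁ S (locp i) (locn k))
      exact mul_le_mul_of_nonneg_left
        (Real.exp_le_exp.2 (neg_le_neg (mul_le_mul_of_nonneg_right hr₁ρ₁ (hD₁ ω (locp i) (locn k))))) (hA₁ ω)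
    have hb : Summable fun ω => A₂ ω * Real.exp (-(ρ₂ * D₂ ω (locn k) (locq j))) := by
      refine summable_of_sum_le hb0 fun S => (Finset.sum_le_sum fun ω _ => ?_).trans (hs₂ S (locn k) (locq j))
      exact mul_le_mul_of_nonneg_left
        (Real.exp_le_exp.2 (neg_le_neg (mul_le_mul_of_nonneg_right hr₂ρ₂ (hD₂ ω (locn k) (locq j))))) (hA₂ ω)
    let f : W₁ → ℂ := fun ω => T₁ ω σ₀ u i k
    let g : W₂ → ℂ := fun ω => T₂ ω σ₀ u k j
    have hfg : Summable fun x : W₁ × W₂ => f x.1 * g x.2 := by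
      refine Summable.of_norm_bounded (ha.mul_of_nonneg hb ha0 hb0) fun x => ?_
      exact (norm_mul_le (f x.1) (g x.2)).trans
        (mul_le_mul (hmaj₁ x.1 σ₀ hσ₀ u hu i k) (hmaj₂ x.2 σ₀ hσ₀ u hu k j) (norm_nonneg _) (ha0 x.1))
    exact HasSum.mul (f := f) (g := g) (hsum₁ σ₀ hσ₀ u hu i k) (hsum₂ σ₀ hσ₀ u hu k j) hfg
  maj ω σ₀ hσ₀ u hu i j :=
    norm_mul_entry_le_of_walks_mirror locp locn locq hfib (hA₁ ω.1) (hA₂ ω.2) hρ hρ₁ hσ hρ₂ (hD₁ ω.1) (hdom₂ ω.2)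
      hrow (fun i k => hmaj₁ ω.1 σ₀ hσ₀ u hu i k) (fun k j => hmaj₂ ω.2 σ₀ hσ₀ u hu k j) i j
  majSum :=
    majSumLe_mul (Nf := Nf) (C := m * c) hA₁ hA₂ hD₁ hD₂ hr₁ hr₂ (mul_nonneg (Nat.cast_nonneg m) hc) hK₁ hK₂ hκ hκ₂ hκ₁
      hrow' hs₁ hs₂
  A_nonneg ω := mul_nonneg (mul_nonneg (Nat.cast_nonneg m) hc) (mul_nonneg (hA₁ ω.1) (hA₂ ω.2))

end Summit.QuantumFields.BalabanUV.T4Continuum.Spine.NE5.ProductWalks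

end
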